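import Summits.FinalStateConjecture.FinalStateConjecture.Theorems.ZeroEnergyKerrOrBombStationaryLimitReductionKerrIsometryRigidityWave3Facts
import Summits.FinalStateConjecture.FinalStateConjecture.Theorems.ZeroEnergyKerrOrBombStationaryLimitReductionKerrIsometryRigidityWave3EndMatching
import Summits.FinalStateConjecture.FinalStateConjecture.Theorems.ZeroEnergyKerrOrBombStationaryLimitReductionTimeEquivariantMaps
import Literature.Geometry.Lorentzian.KerrSchildDecayFine
import Literature.Geometry.Lorentzian.KerrSchildDerivativeDecay
import Literature.Geometry.Lorentzian.KerrScriLeafGap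
import Literature.Geometry.Lorentzian.KerrStarCoord
import Literature.Geometry.Lorentzian.KerrWaveEnergy
import Literature.Geometry.Lorentzian.KerrSchildEnergyEstimate
import HarnessLib

/-!
# Route ZeroEnergyKerrOrBomb · crux `FinalStateFromKerrOrBomb` (stmt-FinalStateConjecture-17839), line `SketchIdeator1` —
# stub `stub_kerrAsymptoticRigidity` (F4 of stub 1R), layer 9a: the TILT has derivative `O(r^{−3/2})` along the slices
Helper file (`--supports stmt-FinalStateConjecture-17839`; helper `kerrAsymptoticRigidity_tilt_fderiv`). Hypotheses: the binder list of
`KerrAsymptoticRigidity` VERBATIM, then `c = 1` (layer 1), the asymptotic Lorentz map `Λ` (layer 6), the drift bound (layer 7), mass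
agreement and bounded radial distortion (layer 8, p139891). Conclusion: for spatial `v`, `‖v‖ ≤ 1`, `|(dΘ_x (0, v))⁰| ≤ C₉ /(r √r)` far out
(the `(e₀, (0, v))` component of the isometry expanded to second order; the `O(1/r)` cross terms cancel). Elementary; nothing restated.
References: Chruściel–Costa arXiv:0806.0016, §2.1; Bartnik, CPAM 39 (1986), §3; Visser arXiv:0706.0622, (32)–(35).
-/

set_option linter.dupNamespace false
set_option maxSynthPendingDepth 3

noncomputable section

open scoped Manifold ContDiff Topology RealInnerProductSpace
open Set Filter Function Bornology

namespace Summit.FinalStateConjecture.FinalStateConjecture.Theorems.SymplecticDualOfTheBomb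

open Literature.Geometry.Lorentzian Summit.FinalStateConjecture.FinalStateConjecture.Theorems.OneLockedExplosion

/-- `‖e₀‖ = 1`. [folklore] -/
private theorem norm_basisVector_zero : ‖(E4.basisVector 0 : E4)‖ = 1 := by rw [E4.basisVector, PiLp.norm_single, norm_one]

/-- `‖(0, y)‖ = ‖y‖`. [folklore] -/
private theorem norm_ofTimeSpace_zero (y : E3) : ‖E4.ofTimeSpace 0 y‖ = ‖y‖ := by
  have h := E4.norm_sq_eq_time_sq_add (E4.ofTimeSpace 0 y)
  rw [E4.ofTimeSpace_apply_zero, E4.spatialNorm_ofTimeSpace] at h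
  nlinarith [norm_nonneg (E4.ofTimeSpace 0 y), norm_nonneg y, sq_nonneg (‖E4.ofTimeSpace 0 y‖ - ‖y‖),
    sq_nonneg (‖E4.ofTimeSpace 0 y‖ + ‖y‖)]

/-- `‖x_{space}‖ ≤ r(x) + |a|` on `{r > 0}`. [folklore] -/
private theorem spatialNorm_le_radius_add {a : ℝ} {x : E4} (hx : 0 < Kerr.radius a x) :
    E4.spatialNorm x ≤ Kerr.radius a x + |a| := by
  have h := Kerr.norm_le_radius_add_abs (a := a) (y := E4.spatial x) (by rwa [Kerr.radius_ofTimeSpace_spatial])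
  rwa [Kerr.radius_ofTimeSpace_spatial] at h

/-- `η(v, w) = −v⁰ w⁰ + ⟪v_{space}, w_{space}⟫`. [folklore] -/
private theorem minkowski_eq_inner (v w : E4) :
    Minkowski.bilin v w = -(v 0 * w 0) + ⟪E4.spatial v, E4.spatial w⟫ := by
  rw [Minkowski.bilin_apply, real_inner_comm, PiLp.inner_apply]
  simp [Fin.sum_univ_three, E4.spatial_apply]

/-- `g_{M,0}(u)(e₀, w) = −w⁰ + (2M/σ)(w⁰ + ⟪u_{space}, w_{space}⟫/σ)`, `σ = ‖u_{space}‖ ≠ 0` (`ℓ = (1, u_{sp}/σ)`). [folklore] -/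
private theorem schw_bilin_e0 (M : ℝ) {u : E4} (hσ : E4.spatialNorm u ≠ 0) (w : E4) :
    Kerr.bilin M 0 u (E4.basisVector 0) w =
      -w 0 + 2 * (M / E4.spatialNorm u) * (w 0 + ⟪E4.spatial u, E4.spatial w⟫ / E4.spatialNorm u) := by
  have hr : Kerr.radius 0 u ≠ 0 := by rwa [Kerr.radius_zero_left]
  have hH : Kerr.scalarH M 0 u = M / E4.spatialNorm u := by
    rw [Kerr.scalarH, Kerr.radius_zero_left]; field_simp; ring
  rw [Kerr.bilin_apply, Minkowski.bilin_basisVector_zero_left, Kerr.nullCovector_basisVector_zero, one_mul,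
    Kerr.nullCovector_zero_apply hr, hH, Kerr.radius_zero_left]

/-- `‖ℓ_a(x) − ℓ_0(x)‖ ≤ C/‖x_{space}‖` far out (`Kerr.isBigOSmooth_nullCovector_sub_zero_ofTimeSpace`, stationarity). [folklore] -/
private theorem exists_norm_nullCovector_sub_le (a : ℝ) :
    ∃ C R : ℝ, 0 < R ∧ ∀ x : E4, R ≤ E4.spatialNorm x →
      ‖Kerr.nullCovector a x - Kerr.nullCovector 0 x‖ ≤ C / E4.spatialNorm x := by
  have hf := Kerr.isBigOSmooth_nullCovector_sub_zero_ofTimeSpace a 0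
  obtain ⟨c, hc⟩ := (hf.isBigO (m := 0) le_rfl).bound
  obtain ⟨R₀, hR₀⟩ := exists_radius_of_eventually_cobounded hc
  refine ⟨c, max R₀ 0 + 1, by positivity, fun x hx ↦ ?_⟩
  have hz : R₀ < ‖E4.spatial x‖ := by change R₀ < E4.spatialNorm x; linarith [le_max_left R₀ 0]
  have hsp : 0 < E4.spatialNorm x := by linarith [le_max_right R₀ 0]
  have h := hR₀ (E4.spatial x) hz
  rw [norm_iteratedFDeriv_zero, Real.norm_of_nonneg (norm_nonneg _),
    show ((-1 : ℝ) - ((0 : ℕ) : ℝ)) = -1 by norm_num, Real.rpow_neg_one,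
    Real.norm_of_nonneg (inv_nonneg.2 (norm_nonneg _))] at h
  have e1 : Kerr.nullCovector a x = Kerr.nullCovector a (E4.ofTimeSpace 0 (E4.spatial x)) :=
    Kerr.eq_slice_spatial_of_time_invariant (fun y t ↦ Kerr.nullCovector_add_smul_basisVector_zero a y t) x
  have e2 : Kerr.nullCovector 0 x = Kerr.nullCovector 0 (E4.ofTimeSpace 0 (E4.spatial x)) :=
    Kerr.eq_slice_spatial_of_time_invariant (fun y t ↦ Kerr.nullCovector_add_smul_basisVector_zero 0 y t) x
  rw [e1, e2, div_eq_mul_inv]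
  exact h

section Lorentz

variable {Λ : E4 →L[ℝ] E4} (hΛ0 : Λ (E4.basisVector 0) = E4.basisVector 0)
  (hΛη : ∀ v w : E4, Minkowski.bilin (Λ v) (Λ w) = Minkowski.bilin v w)
include hΛ0 hΛη

/-- An `η`-orthogonal map fixing `e₀` maps spatial vectors to spatial vectors. [folklore] -/
private theorem map_spatial_apply_zero {p : E4} (hp : p 0 = 0) : Λ p 0 = 0 := by
  have h := hΛη (E4.basisVector 0) p
  rw [hΛ0, Minkowski.bilin_basisVector_zero_left, Minkowski.bilin_basisVector_zero_left, hp, neg_zero,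
    neg_eq_zero] at h
  exact h

omit hΛη in
/-- `(Λ x)_{space} = (Λ (0, x_{space}))_{space}` when `Λ e₀ = e₀`. [folklore] -/
private theorem spatial_map_eq (x : E4) : E4.spatial (Λ x) = E4.spatial (Λ (E4.ofTimeSpace 0 (E4.spatial x))) := by
  conv_lhs => rw [← ofTimeSpace_zero_spatial_add_time_smul x]
  rw [map_add, map_smul, hΛ0, map_add, map_smul, E4.spatial_basisVector_zero, smul_zero, add_zero]

/-- An `η`-orthogonal map fixing `e₀` preserves spatial inner products with spatial vectors. [folklore] -/
private theorem inner_spatial_map (x : E4) (v : E3) :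
    ⟪E4.spatial (Λ x), E4.spatial (Λ (E4.ofTimeSpace 0 v))⟫ = ⟪E4.spatial x, v⟫ := by
  have h := hΛη (E4.ofTimeSpace 0 (E4.spatial x)) (E4.ofTimeSpace 0 v)
  rw [minkowski_eq_inner, minkowski_eq_inner, map_spatial_apply_zero hΛ0 hΛη rfl,
    map_spatial_apply_zero hΛ0 hΛη rfl] at h
  simp only [E4.ofTimeSpace_apply_zero, mul_zero, neg_zero, zero_add, E4.spatial_ofTimeSpace] at h
  rw [spatial_map_eq hΛ0]
  exact h

/-- An `η`-orthogonal map fixing `e₀` preserves the spatial norm. [folklore] -/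
private theorem spatialNorm_map_eq (x : E4) : E4.spatialNorm (Λ x) = E4.spatialNorm x := by
  have h := inner_spatial_map hΛ0 hΛη x (E4.spatial x)
  rw [← spatial_map_eq hΛ0, real_inner_self_eq_norm_sq, real_inner_self_eq_norm_sq] at h
  exact (pow_left_inj₀ (norm_nonneg _) (norm_nonneg _) two_ne_zero).1 h

end Lorentz

/-- **Scalar bookkeeping of the tilt identity** `w⁰ = (2M/σ) w⁰ + (2M/σ²)(ξ + Y) − (2M/r + h)(ξ/ρ + Z) + E`: under the size
hypotheses below, `|w⁰| ≤ K/(r √r)`; the `O(1/r)` terms `2Mξ/σ²` and `2Mξ/(rρ)` cancel up to `O(r⁻²)`. [folklore] -/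
private theorem abs_le_of_tilt_identity {w0 σ r ρ ξ Y Z h E M A₁ L CY CZ Ch CE : ℝ}
    (hid : w0 = 2 * (M / σ) * w0 + 2 * (M / σ ^ 2) * (ξ + Y) - (2 * M / r + h) * (ξ / ρ + Z) + E)
    (hr1 : 1 ≤ r) (hρ1 : r ≤ ρ) (hρ2 : ρ ≤ r + A₁) (hA₁ : 0 ≤ A₁) (hσ : |σ - r| ≤ L) (hL : 0 ≤ L) (hLr : L ≤ r)
    (hσ2 : r / 2 ≤ σ) (hσM : 4 * M ≤ σ) (hM : 0 < M) (hξ : |ξ| ≤ ρ) (hY : |Y| ≤ CY * Real.sqrt r)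
    (hZ : |Z| ≤ CZ / r) (hh : |h| ≤ Ch / r ^ 3) (hE : |E| ≤ CE / r ^ 2) (hCZ : 0 ≤ CZ)
    (hCh : 0 ≤ Ch) (hCE : 0 ≤ CE) :
    |w0| ≤ 2 * (8 * M * (A₁ + 3 * L) + 8 * M * CY + 2 * M * CZ + Ch + Ch * CZ + CE) / (r * Real.sqrt r) := by
  have hr : 0 < r := one_pos.trans_le hr1
  have hρ : 0 < ρ := hr.trans_le hρ1
  have hσ0 : 0 < σ := by linarith
  have hs1 : 1 ≤ Real.sqrt r := by rw [← Real.sqrt_one]; exact Real.sqrt_le_sqrt hr1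
  have hs0 : 0 < Real.sqrt r := one_pos.trans_le hs1
  have hrr : Real.sqrt r * Real.sqrt r = r := Real.mul_self_sqrt hr.le
  have hsr : Real.sqrt r ≤ r := (le_mul_of_one_le_right hs0.le hs1).trans hrr.le
  set D : ℝ := r * Real.sqrt r with hD
  have hD0 : 0 < D := mul_pos hr hs0
  have hDr2 : D ≤ r ^ 2 := by rw [hD, sq]; exact mul_le_mul_of_nonneg_left hsr hr.le
  have hr23 : r ^ 2 ≤ r ^ 3 := by rw [pow_succ]; exact le_mul_of_one_le_right (sq_nonneg r) hr1
  have hr24 : r ^ 2 ≤ r ^ 3 * r := hr23.trans (le_mul_of_one_le_right (by positivity) hr1)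
  have c1 : 1 / r ^ 2 ≤ 1 / D := one_div_le_one_div_of_le hD0 hDr2
  have c2 : 1 / r ^ 3 ≤ 1 / D := one_div_le_one_div_of_le hD0 (hDr2.trans hr23)
  have c4 : 1 / (r ^ 3 * r) ≤ 1 / D := one_div_le_one_div_of_le hD0 (hDr2.trans hr24)
  have c3 : Real.sqrt r / r ^ 2 = 1 / D := by
    rw [hD, div_eq_div_iff (by positivity) hD0.ne', one_mul]
    calc Real.sqrt r * (r * Real.sqrt r) = r * (Real.sqrt r * Real.sqrt r) := by ring
      _ = r ^ 2 := by rw [hrr, sq]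
  have hid' : w0 * (1 - 2 * M / σ) =
      2 * M * ξ * (1 / σ ^ 2 - 1 / (r * ρ)) + 2 * (M / σ ^ 2) * Y - 2 * M / r * Z - h * (ξ / ρ) - h * Z + E := by
    rw [show w0 * (1 - 2 * M / σ) = w0 - 2 * (M / σ) * w0 by ring]
    nth_rewrite 1 [hid]
    ring
  have hcoef : 1 / 2 ≤ 1 - 2 * M / σ := by linarith [show 2 * M / σ ≤ 1 / 2 by rw [div_le_iff₀ hσ0]; linarith]
  have hlhs : |w0| / 2 ≤ |w0 * (1 - 2 * M / σ)| := by
    rw [abs_mul, abs_of_nonneg (show (0 : ℝ) ≤ 1 - 2 * M / σ by linarith)]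
    calc |w0| / 2 = |w0| * (1 / 2) := by ring
      _ ≤ |w0| * (1 - 2 * M / σ) := mul_le_mul_of_nonneg_left hcoef (abs_nonneg _)
  have hσsq : r ^ 2 / 4 ≤ σ ^ 2 := by nlinarith
  have T1 : |2 * M * ξ * (1 / σ ^ 2 - 1 / (r * ρ))| ≤ 8 * M * (A₁ + 3 * L) / D := by
    have e : 1 / σ ^ 2 - 1 / (r * ρ) = (r * ρ - σ ^ 2) / (σ ^ 2 * (r * ρ)) := by field_simp
    have hnum : |r * ρ - σ ^ 2| ≤ (A₁ + 3 * L) * r := by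
      have e2 : r * ρ - σ ^ 2 = r * (ρ - r) - (σ - r) * (σ + r) := by ring
      rw [e2]
      have t1 : |r * (ρ - r)| ≤ r * A₁ := by
        rw [abs_mul, abs_of_pos hr, abs_of_nonneg (by linarith)]; exact mul_le_mul_of_nonneg_left (by linarith) hr.le
      have t2 : |(σ - r) * (σ + r)| ≤ L * (3 * r) := by
        rw [abs_mul]
        refine mul_le_mul hσ ?_ (abs_nonneg _) hL
        rw [abs_le]; constructor <;> linarith [(abs_le.1 hσ).1, (abs_le.1 hσ).2]
      calc _ ≤ |r * (ρ - r)| + |(σ - r) * (σ + r)| := abs_sub _ _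
        _ ≤ r * A₁ + L * (3 * r) := add_le_add t1 t2
        _ = (A₁ + 3 * L) * r := by ring
    rw [e, abs_mul, abs_mul, abs_mul, abs_div, abs_of_pos hM, abs_two,
      abs_of_pos (by positivity : (0 : ℝ) < σ ^ 2 * (r * ρ))]
    calc 2 * M * |ξ| * (|r * ρ - σ ^ 2| / (σ ^ 2 * (r * ρ)))
        ≤ 2 * M * ρ * ((A₁ + 3 * L) * r / (σ ^ 2 * (r * ρ))) := by gcongr
      _ = 2 * M * (A₁ + 3 * L) / σ ^ 2 := by field_simp
      _ ≤ 2 * M * (A₁ + 3 * L) / (r ^ 2 / 4) := div_le_div_of_nonneg_left (by positivity) (by positivity) hσsq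
      _ = 8 * M * (A₁ + 3 * L) * (1 / r ^ 2) := by
          field_simp; ring
      _ ≤ 8 * M * (A₁ + 3 * L) * (1 / D) := by gcongr
      _ = 8 * M * (A₁ + 3 * L) / D := by ring
  have T2 : |2 * (M / σ ^ 2) * Y| ≤ 8 * M * CY / D := by
    rw [abs_mul, abs_mul, abs_two, abs_div, abs_of_pos hM, abs_of_pos (by positivity : (0 : ℝ) < σ ^ 2)]
    calc 2 * (M / σ ^ 2) * |Y| ≤ 2 * (M / (r ^ 2 / 4)) * (CY * Real.sqrt r) := by gcongr
      _ = 8 * M * CY * (Real.sqrt r / r ^ 2) := by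
          field_simp; ring
      _ = 8 * M * CY / D := by rw [c3]; ring
  have T3 : |2 * M / r * Z| ≤ 2 * M * CZ / D := by
    rw [abs_mul, abs_div, abs_mul, abs_two, abs_of_pos hM, abs_of_pos hr]
    calc 2 * M / r * |Z| ≤ 2 * M / r * (CZ / r) := by gcongr
      _ = 2 * M * CZ * (1 / r ^ 2) := by field_simp
      _ ≤ 2 * M * CZ * (1 / D) := by gcongr
      _ = 2 * M * CZ / D := by ring
  have T4 : |h * (ξ / ρ)| ≤ Ch / D := by
    rw [abs_mul, abs_div, abs_of_pos hρ]
    have : |ξ| / ρ ≤ 1 := (div_le_one hρ).2 hξ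
    calc |h| * (|ξ| / ρ) ≤ Ch / r ^ 3 * 1 := by gcongr
      _ = Ch * (1 / r ^ 3) := by ring
      _ ≤ Ch * (1 / D) := by gcongr
      _ = Ch / D := by ring
  have T5 : |h * Z| ≤ Ch * CZ / D := by
    rw [abs_mul]
    calc |h| * |Z| ≤ Ch / r ^ 3 * (CZ / r) := by gcongr
      _ = Ch * CZ * (1 / (r ^ 3 * r)) := by field_simp
      _ ≤ Ch * CZ * (1 / D) := by gcongr
      _ = Ch * CZ / D := by ring
  have T6 : |E| ≤ CE / D := hE.trans (by rw [div_eq_mul_one_div, div_eq_mul_one_div CE D]; gcongr)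
  have hsum : |w0 * (1 - 2 * M / σ)| ≤
      (8 * M * (A₁ + 3 * L) + 8 * M * CY + 2 * M * CZ + Ch + Ch * CZ + CE) / D := by
    rw [hid']
    have s1 := abs_add_le (2 * M * ξ * (1 / σ ^ 2 - 1 / (r * ρ)) + 2 * (M / σ ^ 2) * Y - 2 * M / r * Z -
      h * (ξ / ρ) - h * Z) E
    have s2 := abs_sub (2 * M * ξ * (1 / σ ^ 2 - 1 / (r * ρ)) + 2 * (M / σ ^ 2) * Y - 2 * M / r * Z - h * (ξ / ρ))
      (h * Z)
    have s3 := abs_sub (2 * M * ξ * (1 / σ ^ 2 - 1 / (r * ρ)) + 2 * (M / σ ^ 2) * Y - 2 * M / r * Z) (h * (ξ / ρ))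
    have s4 := abs_sub (2 * M * ξ * (1 / σ ^ 2 - 1 / (r * ρ)) + 2 * (M / σ ^ 2) * Y) (2 * M / r * Z)
    have s5 := abs_add_le (2 * M * ξ * (1 / σ ^ 2 - 1 / (r * ρ))) (2 * (M / σ ^ 2) * Y)
    have e : (8 * M * (A₁ + 3 * L) + 8 * M * CY + 2 * M * CZ + Ch + Ch * CZ + CE) / D =
        8 * M * (A₁ + 3 * L) / D + 8 * M * CY / D + 2 * M * CZ / D + Ch / D + Ch * CZ / D + CE / D := by field_simp
    rw [e]; linarith
  have hfin : |w0| / 2 ≤ (8 * M * (A₁ + 3 * L) + 8 * M * CY + 2 * M * CZ + Ch + Ch * CZ + CE) / D := hlhs.trans hsum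
  rw [mul_div_assoc]; linarith

/-- **Registered helper `kerrAsymptoticRigidity_tilt_fderiv`** (layer 9a of F4 = `KerrAsymptoticRigidity`; its binder list verbatim,
then `c = 1`, the asymptotic Lorentz map `Λ` with its rate and drift bounds (layers 6–7), mass agreement and bounded radial distortion
(layer 8)): far out, for every `v ∈ E3` with `‖v‖ ≤ 1`, `|(dΘ_x (0, v))⁰| ≤ C₉ /(r √r)` — the `(e₀, (0, v))` component of the isometry,
expanded to second order, fed to `abs_le_of_tilt_identity`. Chruściel–Costa arXiv:0806.0016, §2.1; Bartnik 1986, §3. [folklore] -/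
theorem kerrAsymptoticRigidity_tilt_fderiv : ∀ (𝓑 : StationaryAFBlackHole.{0}) (A : 𝓑.AdaptedChart) (M a c : ℝ) (Θ : E4 → E4), ChartIsAsymptoticallyCartesian A → ChartIsAsymptoticallySchwarzschildean' A → Kerr.IsSubextremal M a → 0 < c → ContDiffOn ℝ ∞ Θ (Kerr.exterior M a : Set E4) → Set.InjOn Θ (Kerr.exterior M a : Set E4) → Set.MapsTo Θ (Kerr.exterior M a : Set E4) (A.domain : Set E4) → (∀ x ∈ (Kerr.exterior M a : Set E4), ∀ s : ℝ, Θ (x + s • E4.basisVector 0) = Θ x + (c * s) • E4.basisVector 0) → (∀ x ∈ (Kerr.exterior M a : Set E4), ∀ v w : E4, A.bilin (Θ x) (fderiv ℝ Θ x v) (fderiv ℝ Θ x w) = Kerr.bilin M a x v w) → Θ '' (Kerr.exterior M a : Set E4) = {u : E4 | ∃ h : u ∈ A.domain, A.toFun ⟨u, h⟩ ∈ 𝓑.doc} → (∀ R₁ : ℝ, ∃ R : ℝ, ∀ x ∈ (Kerr.exterior M a : Set E4), R ≤ Kerr.radius a x → R₁ ≤ A.radius (Θ x)) → c = 1 → ∀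 (Λ : E4 →L[ℝ] E4) (R₆ C₆ R₇ C₇ : ℝ), Λ (E4.basisVector 0) = c • E4.basisVector 0 → (∀ v w : E4, Minkowski.bilin (Λ v) (Λ w) = Minkowski.bilin v w) → (∀ x ∈ (Kerr.exterior M a : Set E4), R₆ ≤ Kerr.radius a x → ‖fderiv ℝ Θ x - Λ‖ ≤ C₆ / Kerr.radius a x) → (∀ x ∈ (Kerr.exterior M a : Set E4), R₇ ≤ Kerr.radius a x → ‖Θ x - Λ x‖ ≤ C₇ * Real.sqrt (Kerr.radius a x)) → (∃ C R₀ : ℝ, ∀ x : A.domain, R₀ ≤ A.radius x.1 → ∀ n : ℕ, n ≤ 2 → ‖iteratedFDeriv ℝ n (fun y ↦ A.bilin y - Kerr.bilin M 0 y) x.1‖ ≤ C / (A.radius x.1) ^ (n + 2)) → (∃ R₈ L₈ : ℝ, ∀ x ∈ (Kerr.exterior M a : Set E4), R₈ ≤ Kerr.radius a x → |A.radius (Θ x) - Kerr.radius a x| ≤ L₈) → ∃ R₉ C₉ : ℝ, ∀ x ∈ (Kerr.exterior M a : Set E4), R₉ ≤ Kerr.radius a x → ∀ v : E3, ‖v‖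 ≤ 1 → |fderiv ℝ Θ x (E4.ofTimeSpace 0 v) 0| ≤ C₉ / (Kerr.radius a x * Real.sqrt (Kerr.radius a x)) := by
  intro 𝓑 A M a c Θ _ _ hMa _ hΘs _ hΘmaps hΘT hΘiso _ hfar hc1 Λ R₆ C₆ R₇ C₇ hΛ0 hΛη hrate hdrift hmass hrad
  subst hc1
  rw [one_smul] at hΛ0
  obtain ⟨CA, RA, hder⟩ := hmass
  obtain ⟨R₈, L₈, hR₈⟩ := hrad
  set S : Set E4 := (Kerr.exterior M a : Set E4) with hS_def
  have hSo : IsOpen S := (Kerr.exterior M a).isOpen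
  have hM : 0 < M := hMa.pos
  obtain ⟨CA0, hCA0⟩ := A.exists_abs_radius_sub_spatialNorm_le
  obtain ⟨Cℓ, Rℓ, hRℓ0, hℓ⟩ := exists_norm_nullCovector_sub_le a
  obtain ⟨R₂, hR₂⟩ := hfar RA
  set L : ℝ := |L₈| + |CA0| with hL_def
  have hL0 : 0 ≤ L := by positivity
  set CY : ℝ := 2 * |C₆| + |C₇| * ‖Λ‖ + |C₇| * |C₆| with hCY
  set CE : ℝ := 4 * |CA| * (‖Λ‖ + |C₆|) with hCE
  set K : ℝ := 2 * (8 * M * (|a| + 3 * L) + 8 * M * CY + 2 * M * |Cℓ| + 2 * M * a ^ 2 +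
    2 * M * a ^ 2 * |Cℓ| + CE) with hK
  set R₉ : ℝ := |R₆| + |R₇| + |R₈| + |R₂| + Rℓ + 1 + |a| + 2 * L + 8 * M with hR₉
  refine ⟨R₉, K, fun x hx hxR v hv ↦ ?_⟩
  set r : ℝ := Kerr.radius a x with hr_def
  have hr : 0 < r := Kerr.radius_pos_of_mem_region hx
  have hthr : 1 ≤ r ∧ R₆ ≤ r ∧ R₇ ≤ r ∧ R₈ ≤ r ∧ R₂ ≤ r ∧ Rℓ ≤ r ∧ |a| ≤ r ∧ L ≤ r ∧ 8 * M ≤ r ∧ 2 * L ≤ r := by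
    refine ⟨?_, ?_, ?_, ?_, ?_, ?_, ?_, ?_, ?_, ?_⟩ <;> linarith [le_abs_self R₆, le_abs_self R₇, le_abs_self R₈,
      le_abs_self R₂, abs_nonneg R₆, abs_nonneg R₇, abs_nonneg R₈, abs_nonneg R₂, abs_nonneg a]
  obtain ⟨hr1, hR6, hR7, hR8, hR2, hRℓ, ha, hLr, h8M, h2L⟩ := hthr
  set hh : ℝ := 2 * Kerr.scalarH M a x - 2 * M / r with hhh
  have hhb : |hh| ≤ 2 * M * a ^ 2 / r ^ 3 := by
    have hHlo : M * r / (r ^ 2 + a ^ 2) ≤ Kerr.scalarH M a x := Kerr.div_le_scalarH hM.le hr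
    have hHhi : Kerr.scalarH M a x ≤ M / r := Kerr.scalarH_le_div hM.le a hr
    rw [hhh, abs_sub_comm, abs_of_nonneg (by rw [mul_div_assoc]; linarith)]
    have e1 : M / r - M * r / (r ^ 2 + a ^ 2) = M * a ^ 2 / (r * (r ^ 2 + a ^ 2)) := by
      field_simp; ring
    have e2 : M * a ^ 2 / (r * (r ^ 2 + a ^ 2)) ≤ M * a ^ 2 / r ^ 3 :=
      div_le_div_of_nonneg_left (by positivity) (by positivity)
        (by rw [show r * (r ^ 2 + a ^ 2) = r ^ 3 + r * a ^ 2 by ring]; linarith [mul_nonneg hr.le (sq_nonneg a)])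
    have e3 : 2 * M / r - 2 * Kerr.scalarH M a x ≤ 2 * (M / r - M * r / (r ^ 2 + a ^ 2)) := by rw [mul_div_assoc]; linarith
    have e4 : 2 * M * a ^ 2 / r ^ 3 = 2 * (M * a ^ 2 / r ^ 3) := by ring
    rw [e4]; linarith
  set ρ : ℝ := E4.spatialNorm x with hρ_def
  have hρ1 : r ≤ ρ := Kerr.radius_le_spatialNorm a x
  have hρ2 : ρ ≤ r + |a| := spatialNorm_le_radius_add hr
  have hρ0 : 0 < ρ := hr.trans_le hρ1
  set u : E4 := Θ x with hu_def
  set σ : ℝ := E4.spatialNorm u with hσ_def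
  set rA : ℝ := A.radius u with hrA_def
  have hrad' : |rA - r| ≤ L₈ := hR₈ x hx hR8
  have hAσ : |rA - σ| ≤ CA0 := hCA0 u
  have hσ : |σ - r| ≤ L := by
    calc |σ - r| ≤ |σ - rA| + |rA - r| := abs_sub_le _ _ _
      _ ≤ |CA0| + |L₈| := add_le_add (by rw [abs_sub_comm]; exact hAσ.trans (le_abs_self _)) (hrad'.trans (le_abs_self _))
      _ = L := by rw [hL_def]; ring
  have hσ2 : r / 2 ≤ σ := by linarith [(abs_le.1 hσ).1]
  have hσM : 4 * M ≤ σ := by linarith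
  have hσ0 : 0 < σ := by linarith
  have hrA : r / 2 ≤ rA := by linarith [(abs_le.1 hrad').1, le_abs_self L₈, abs_nonneg CA0]
  have hrA0 : 0 < rA := by linarith
  have hRA : RA ≤ rA := hR₂ x hx hR2
  set P : E4 →L[ℝ] E4 := fderiv ℝ Θ x with hP_def
  set q : E4 := E4.ofTimeSpace 0 v with hq_def
  set w : E4 := P q with hw_def
  have hq1 : ‖q‖ ≤ 1 := by rw [hq_def, norm_ofTimeSpace_zero]; exact hv
  have hPΛ : ‖P - Λ‖ ≤ C₆ / r := hrate x hx hR6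
  have hPΛ' : ‖P - Λ‖ ≤ |C₆| / r := hPΛ.trans (by gcongr; exact le_abs_self _)
  have hC6r : |C₆| / r ≤ |C₆| := div_le_self (abs_nonneg _) hr1
  set ε : E4 := (P - Λ) q with hε_def
  have hwε : w = Λ q + ε := by rw [hε_def, sub_apply, add_sub_cancel]
  have hε : ‖ε‖ ≤ |C₆| / r :=
    ((P - Λ).le_opNorm q).trans ((mul_le_mul hPΛ' hq1 (norm_nonneg _) (by positivity)).trans (by rw [mul_one]))
  have hw : ‖w‖ ≤ ‖Λ‖ + |C₆| := by
    rw [hwε]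
    refine (norm_add_le _ _).trans (add_le_add ?_ (hε.trans hC6r))
    exact (Λ.le_opNorm q).trans ((mul_le_mul_of_nonneg_left hq1 (norm_nonneg _)).trans (by rw [mul_one]))
  set δ : E4 := Θ x - Λ x with hδ_def
  have hδ : ‖δ‖ ≤ C₇ * Real.sqrt r := hdrift x hx hR7
  have hs1 : 1 ≤ Real.sqrt r := by rw [← Real.sqrt_one]; exact Real.sqrt_le_sqrt hr1
  have he₀ : P (E4.basisVector 0) = E4.basisVector 0 := by
    have h := fderiv_apply_basisVector_zero_of_contDiffOn hSo (by simp) hΘs hΘT hx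
    rwa [one_smul] at h
  have hF : A.bilin u (E4.basisVector 0) w = 2 * Kerr.scalarH M a x * Kerr.nullCovector a x q := by
    have h := hΘiso x hx (E4.basisVector 0) q
    rw [he₀] at h
    rw [hw_def, hu_def, hP_def, h, hq_def, Kerr.bilin_apply, Minkowski.bilin_basisVector_zero_left,
      E4.ofTimeSpace_apply_zero, neg_zero, zero_add, Kerr.nullCovector_basisVector_zero, one_mul]
  set E : ℝ := A.bilin u (E4.basisVector 0) w - Kerr.bilin M 0 u (E4.basisVector 0) w with hE_def
  have hEb : |E| ≤ CE / r ^ 2 := by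
    have h0 := hder ⟨u, hΘmaps hx⟩ hRA 0 (by norm_num)
    rw [norm_iteratedFDeriv_zero] at h0
    simp only [zero_add] at h0
    have h1 := (A.bilin u - Kerr.bilin M 0 u).le_opNorm₂ (E4.basisVector 0) w
    rw [sub_apply, sub_apply, norm_basisVector_zero, mul_one, Real.norm_eq_abs] at h1
    calc |E| ≤ ‖A.bilin u - Kerr.bilin M 0 u‖ * ‖w‖ := h1
      _ ≤ (CA / rA ^ 2) * (‖Λ‖ + |C₆|) := mul_le_mul h0 hw (norm_nonneg _) ((norm_nonneg _).trans h0)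
      _ ≤ (|CA| / (r / 2) ^ 2) * (‖Λ‖ + |C₆|) := by
          refine mul_le_mul_of_nonneg_right ?_ (by positivity)
          calc CA / rA ^ 2 ≤ |CA| / rA ^ 2 := by gcongr; exact le_abs_self _
            _ ≤ |CA| / (r / 2) ^ 2 := div_le_div_of_nonneg_left (abs_nonneg _) (by positivity)
                (pow_le_pow_left₀ (by positivity) hrA 2)
      _ = CE / r ^ 2 := by rw [hCE]; field_simp; ring
  have hK0 := schw_bilin_e0 M hσ0.ne' w
  set ξ : ℝ := ⟪E4.spatial x, v⟫ with hξ_def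
  have hξb : |ξ| ≤ ρ := (abs_real_inner_le_norm _ _).trans (by
    rw [hρ_def, E4.spatialNorm]; exact (mul_le_mul_of_nonneg_left hv (norm_nonneg _)).trans (by rw [mul_one]))
  set Y : ℝ := ⟪E4.spatial u, E4.spatial w⟫ - ξ with hY_def
  have hYb : |Y| ≤ CY * Real.sqrt r := by
    have eu : E4.spatial u = E4.spatial (Λ x) + E4.spatial δ := by rw [← map_add, hδ_def, add_sub_cancel]
    have ew : E4.spatial w = E4.spatial (Λ q) + E4.spatial ε := by rw [← map_add, ← hwε]
    have key : ⟪E4.spatial (Λ x), E4.spatial (Λ q)⟫ = ξ := inner_spatial_map hΛ0 hΛη x v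
    have eY : Y = ⟪E4.spatial (Λ x), E4.spatial ε⟫ + ⟪E4.spatial δ, E4.spatial (Λ q)⟫ + ⟪E4.spatial δ, E4.spatial ε⟫ := by
      rw [hY_def, eu, ew, inner_add_left, inner_add_right, inner_add_right, key]
      ring
    have n1 : ‖E4.spatial (Λ x)‖ ≤ 2 * r := by
      change E4.spatialNorm (Λ x) ≤ 2 * r
      rw [spatialNorm_map_eq hΛ0 hΛη]
      linarith
    have n2 : ‖E4.spatial ε‖ ≤ |C₆| / r := (E4.spatialNorm_le_norm ε).trans hε
    have n3 : ‖E4.spatial δ‖ ≤ C₇ * Real.sqrt r := (E4.spatialNorm_le_norm δ).trans hδ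
    have n4 : ‖E4.spatial (Λ q)‖ ≤ ‖Λ‖ := (E4.spatialNorm_le_norm _).trans
      ((Λ.le_opNorm q).trans ((mul_le_mul_of_nonneg_left hq1 (norm_nonneg _)).trans (by rw [mul_one])))
    have hC7 : C₇ * Real.sqrt r ≤ |C₇| * Real.sqrt r := by gcongr; exact le_abs_self _
    have t1 : |⟪E4.spatial (Λ x), E4.spatial ε⟫| ≤ 2 * |C₆| :=
      calc _ ≤ ‖E4.spatial (Λ x)‖ * ‖E4.spatial ε‖ := abs_real_inner_le_norm _ _
        _ ≤ (2 * r) * (|C₆| / r) := mul_le_mul n1 n2 (norm_nonneg _) (by positivity)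
        _ = 2 * |C₆| := by field_simp
    have t2 : |⟪E4.spatial δ, E4.spatial (Λ q)⟫| ≤ |C₇| * Real.sqrt r * ‖Λ‖ :=
      (abs_real_inner_le_norm _ _).trans (mul_le_mul (n3.trans hC7) n4 (norm_nonneg _) (by positivity))
    have t3 : |⟪E4.spatial δ, E4.spatial ε⟫| ≤ |C₇| * Real.sqrt r * |C₆| :=
      (abs_real_inner_le_norm _ _).trans (mul_le_mul (n3.trans hC7) (n2.trans hC6r) (norm_nonneg _) (by positivity))
    rw [eY]
    calc _ ≤ |⟪E4.spatial (Λ x), E4.spatial ε⟫ + ⟪E4.spatial δ, E4.spatial (Λ q)⟫| + |⟪E4.spatial δ, E4.spatial ε⟫| :=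
          abs_add_le _ _
      _ ≤ (|⟪E4.spatial (Λ x), E4.spatial ε⟫| + |⟪E4.spatial δ, E4.spatial (Λ q)⟫|) + |⟪E4.spatial δ, E4.spatial ε⟫| := by
          gcongr; exact abs_add_le _ _
      _ ≤ (2 * |C₆| + |C₇| * Real.sqrt r * ‖Λ‖) + |C₇| * Real.sqrt r * |C₆| := add_le_add (add_le_add t1 t2) t3
      _ ≤ (2 * |C₆| * Real.sqrt r + |C₇| * Real.sqrt r * ‖Λ‖) + |C₇| * Real.sqrt r * |C₆| :=
          add_le_add (add_le_add (le_mul_of_one_le_right (by positivity) hs1) le_rfl) le_rfl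
      _ = CY * Real.sqrt r := by rw [hCY]; ring
  set Z : ℝ := Kerr.nullCovector a x q - ξ / ρ with hZ_def
  have hZb : |Z| ≤ |Cℓ| / r := by
    have hρ' : Kerr.radius 0 x ≠ 0 := by rw [Kerr.radius_zero_left]; exact hρ0.ne'
    have e0 : Kerr.nullCovector 0 x q = ξ / ρ := by
      rw [Kerr.nullCovector_zero_apply hρ', Kerr.radius_zero_left, hq_def, E4.ofTimeSpace_apply_zero, zero_add,
        E4.spatial_ofTimeSpace]
    have e1 : Z = (Kerr.nullCovector a x - Kerr.nullCovector 0 x) q := by rw [sub_apply, e0]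
    rw [e1, ← Real.norm_eq_abs]
    calc _ ≤ ‖Kerr.nullCovector a x - Kerr.nullCovector 0 x‖ * ‖q‖ := ContinuousLinearMap.le_opNorm _ _
      _ ≤ (Cℓ / ρ) * 1 := mul_le_mul (hℓ x (hRℓ.trans hρ1)) hq1 (norm_nonneg _) ((norm_nonneg _).trans (hℓ x (hRℓ.trans hρ1)))
      _ ≤ |Cℓ| / r := by
          rw [mul_one]
          exact (div_le_div_of_nonneg_right (le_abs_self _) hρ0.le).trans
            (div_le_div_of_nonneg_left (abs_nonneg _) hr hρ1)
  have hid : w 0 = 2 * (M / σ) * w 0 + 2 * (M / σ ^ 2) * (ξ + Y) - (2 * M / r + hh) * (ξ / ρ + Z) + E := by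
    have e1 : A.bilin u (E4.basisVector 0) w = Kerr.bilin M 0 u (E4.basisVector 0) w + E := by rw [hE_def]; ring
    have e2 : 2 * Kerr.scalarH M a x = 2 * M / r + hh := by rw [hhh]; ring
    have e3 : Kerr.nullCovector a x q = ξ / ρ + Z := by rw [hZ_def]; ring
    have e4 : ⟪E4.spatial u, E4.spatial w⟫ = ξ + Y := by rw [hY_def]; ring
    have h5 : Kerr.bilin M 0 u (E4.basisVector 0) w + E = (2 * M / r + hh) * (ξ / ρ + Z) := by rw [← e1, hF, e2, e3]
    rw [hK0, e4] at h5
    have e5 : 2 * (M / σ) * (w 0 + (ξ + Y) / σ) = 2 * (M / σ) * w 0 + 2 * (M / σ ^ 2) * (ξ + Y) := by field_simp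
    rw [← hσ_def, e5] at h5
    linarith
  exact abs_le_of_tilt_identity hid hr1 hρ1 hρ2 (abs_nonneg a) hσ hL0 hLr hσ2 hσM hM hξb hYb hZb hhb hEb
    (abs_nonneg _) (by positivity) (by positivity)

end Summit.FinalStateConjecture.FinalStateConjecture.Theorems.SymplecticDualOfTheBomb

end
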